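import Literature.Geometry.Lorentzian.Basic
import Literature.Topology.Euclidean.InvarianceOfDomain
import Mathlib.Geometry.Manifold.Instances.Sphere
import Mathlib.Geometry.Manifold.IsManifold.Basic
import Mathlib.Geometry.Manifold.ContMDiff.Atlas
import HarnessLib

/-!
# Crux `HawkingExtensionIsKerr` (stmt-FinalStateConjecture-17840), line `SketchIdeator2` —
# programme SEC, brick SEC-4: invariance of domain on sphere-like spaces; finite smooth atlases

Helper file of the line lead (c7), registered sub-goal `stub_sec_atlas` (generic topology /
Mathlib manifold plumbing, no Lorentzian geometry).  Programme SEC puts a smooth `2`-manifold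
structure on a compact set `C ≃ₜ S²` (a component of a horizon cross-section) out of finitely many
"leaf coordinate" maps `f i : C → ℝ²`, continuous and injective on open sets `V i`; this file
supplies the two generic ingredients:

* (i) `isOpen_image_of_injOn_of_sphereLike` — **invariance of domain on a space homeomorphic to
  `S²`**: for `e : C ≃ₜ S²`, `W ⊆ C` open and `f : C → ℝ²` continuous and injective on `W`, the image
  `f '' W` is open.  Proof: around `c ∈ W` transport through `e` and the chart
  `φ = chartAt ℝ² (e c)` of Mathlib's sphere (`EuclideanSpace.instChartedSpaceSphere`, stereographic
  projection); `g = f ∘ e⁻¹ ∘ φ⁻¹` is continuous and injective on the open set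
  `φ.target ∩ φ⁻¹ (e⁻¹ ⁻¹' W) ⊆ ℝ²`, so its image is open by the tree's Brouwer invariance of domain
  (`Literature.Topology.Euclidean.Brouwer.isOpen_image_of_injOn`), contains `f c` and lies in `f '' W`.
* (ii) `exists_isManifold_of_finite_charts` — **finite smooth atlases**: a finite family of maps
  `f i : X → ℝ²`, continuous on open sets `V i` covering `X`, open on `V i`, with left inverses
  `fi i` and `C^∞` transition maps `f j ∘ fi i` on `f i '' (V i ∩ V j)`, is the atlas of a
  `ChartedSpace ℝ² X` / `IsManifold (𝓡 2) ∞ X` structure (`OpenPartialHomeomorph.ofContinuousOpenRestrict`,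
  `isManifold_of_contDiffOn`) in which every `f i` is `C^∞` on `V i` and every `fi i` is `C^∞` on
  `f i '' V i` (`contMDiffOn_of_mem_maximalAtlas`, `contMDiffOn_symm_of_mem_maximalAtlas`).

`stub_sec_atlas` is the registered conjunction, verbatim.
-/

noncomputable section

set_option linter.dupNamespace false

namespace Summit.FinalStateConjecture.FinalStateConjecture.Theorems.HawkingExtensionIsKerr.SketchIdeator2

open Set Filter Bundle Function Literature.Geometry.Lorentzian
open scoped Manifold ContDiff Topology

/-! ### (i) Invariance of domain on a space homeomorphic to the `2`-sphere -/

/-- **Invariance of domain on a sphere-like space.**  If `e : C ≃ₜ S²` (the unit sphere of `ℝ³`),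
`W ⊆ C` is open and `f : C → ℝ²` is continuous and injective on `W`, then `f '' W` is open in `ℝ²`.
Around `c ∈ W`: with `φ = chartAt ℝ² (e c)` (stereographic chart of Mathlib's sphere) the map
`g = f ∘ e.symm ∘ φ.symm` is continuous and injective on the open set
`O = φ.target ∩ φ.symm ⁻¹' (e.symm ⁻¹' W)`, hence `g '' O` is open (Brouwer,
`Literature.Topology.Euclidean.Brouwer.isOpen_image_of_injOn`), and `f c ∈ g '' O ⊆ f '' W`. -/
theorem isOpen_image_of_injOn_of_sphereLike {C : Type*} [TopologicalSpace C]
    (e : C ≃ₜ Metric.sphere (0 : E3) 1) {W : Set C} {f : C → EuclideanSpace ℝ (Fin 2)}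
    (hW : IsOpen W) (hf : ContinuousOn f W) (hinj : InjOn f W) : IsOpen (f '' W) := by
  rw [isOpen_iff_forall_mem_open]
  rintro _ ⟨c, hc, rfl⟩
  set φ := chartAt (EuclideanSpace ℝ (Fin 2)) (e c) with hφ
  set O : Set (EuclideanSpace ℝ (Fin 2)) := φ.target ∩ φ.symm ⁻¹' (e.symm ⁻¹' W) with hO
  have hOopen : IsOpen O := φ.symm.isOpen_inter_preimage (hW.preimage e.symm.continuous)
  have hmaps : MapsTo (fun y => e.symm (φ.symm y)) O W := fun y hy => hy.2
  have hgc : ContinuousOn (fun y => f (e.symm (φ.symm y))) O :=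
    hf.comp (e.symm.continuous.comp_continuousOn (φ.continuousOn_symm.mono inter_subset_left))
      hmaps
  have hginj : InjOn (fun y => f (e.symm (φ.symm y))) O := by
    intro y hy y' hy' h
    have h1 : e.symm (φ.symm y) = e.symm (φ.symm y') := hinj hy.2 hy'.2 h
    exact φ.symm.injOn hy.1 hy'.1 (e.symm.injective h1)
  have hopen : IsOpen ((fun y => f (e.symm (φ.symm y))) '' O) :=
    Literature.Topology.Euclidean.Brouwer.isOpen_image_of_injOn rfl hOopen hgc hginj
  refine ⟨(fun y => f (e.symm (φ.symm y))) '' O, ?_, hopen, ?_⟩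
  · rintro _ ⟨y, hy, rfl⟩
    exact ⟨e.symm (φ.symm y), hy.2, rfl⟩
  · have hsrc : e c ∈ φ.source := mem_chart_source _ _
    refine ⟨φ (e c), ⟨φ.map_source hsrc, ?_⟩, ?_⟩
    · show e.symm (φ.symm (φ (e c))) ∈ W
      rw [φ.left_inv hsrc, e.symm_apply_apply]
      exact hc
    · show f (e.symm (φ.symm (φ (e c)))) = f c
      rw [φ.left_inv hsrc, e.symm_apply_apply]

/-! ### (ii) Finite smooth atlases -/

/-- A map `f : X → ℝ²` continuous on an open set `V`, open on `V` (images of open subsets of `V`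
are open) and with a left inverse `fi` on `V` is (the underlying function of) an open partial
homeomorphism `X ⇀ ℝ²` with source `V`, target `f '' V` and inverse `fi`
(`OpenPartialHomeomorph.ofContinuousOpenRestrict`). -/
theorem exists_openPartialHomeomorph_of_isOpen_image {X : Type*} [TopologicalSpace X] {V : Set X}
    {f : X → EuclideanSpace ℝ (Fin 2)} {fi : EuclideanSpace ℝ (Fin 2) → X} (hV : IsOpen V)
    (hf : ContinuousOn f V) (hopen : ∀ V' ⊆ V, IsOpen V' → IsOpen (f '' V'))
    (hleft : ∀ x ∈ V, fi (f x) = x) :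
    ∃ e : OpenPartialHomeomorph X (EuclideanSpace ℝ (Fin 2)),
      e.source = V ∧ e.target = f '' V ∧ ⇑e = f ∧ ⇑e.symm = fi := by
  let p : PartialEquiv X (EuclideanSpace ℝ (Fin 2)) :=
    { toFun := f
      invFun := fi
      source := V
      target := f '' V
      map_source' := fun x hx => mem_image_of_mem f hx
      map_target' := by
        rintro _ ⟨x, hx, rfl⟩
        show fi (f x) ∈ V
        rw [hleft x hx]
        exact hx
      left_inv' := fun x hx => hleft x hx
      right_inv' := by
        rintro _ ⟨x, hx, rfl⟩
        show f (fi (f x)) = f x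
        rw [hleft x hx] }
  have ho : IsOpenMap (p.source.restrict p) := by
    intro O hO
    have hO' : IsOpen (Subtype.val '' O) := hV.isOpenMap_subtype_val _ hO
    rw [show p.source.restrict p '' O = f '' (Subtype.val '' O) by rw [Set.image_image]; rfl]
    exact hopen _ (Subtype.coe_image_subset V O) hO'
  exact ⟨OpenPartialHomeomorph.ofContinuousOpenRestrict p hf ho hV, rfl, rfl, rfl, rfl⟩

/-- **Finite smooth atlases.**  Let `X` be a topological space covered by open sets `V i`
(`i : Fin N`) carrying maps `f i : X → ℝ²` continuous and open on `V i` with left inverses `fi i`,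
such that all transition maps `f j ∘ fi i` are `C^∞` on `f i '' (V i ∩ V j)`.  Then the open partial
homeomorphisms `(V i, f i, fi i)` form an atlas of a `C^∞` manifold structure on `X` modelled on
`ℝ²` (`isManifold_of_contDiffOn`: the transition `(chart i).symm ≫ₕ chart j` is `f j ∘ fi i` on its
source `f i '' V i ∩ (fi i)⁻¹' (V j) ⊆ f i '' (V i ∩ V j)`), in which each `f i` is `C^∞` on `V i`
and each `fi i` is `C^∞` on `f i '' V i` (members of the atlas and their inverses are `C^∞`,
`contMDiffOn_of_mem_maximalAtlas` / `contMDiffOn_symm_of_mem_maximalAtlas`). -/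
theorem exists_isManifold_of_finite_charts {X : Type*} [TopologicalSpace X] {N : ℕ}
    {V : Fin N → Set X} {f : Fin N → X → EuclideanSpace ℝ (Fin 2)}
    {fi : Fin N → EuclideanSpace ℝ (Fin 2) → X} (hV : ∀ i, IsOpen (V i)) (hcover : ∀ x, ∃ i, x ∈ V i)
    (hf : ∀ i, ContinuousOn (f i) (V i)) (hopen : ∀ i, ∀ V' ⊆ V i, IsOpen V' → IsOpen (f i '' V'))
    (hleft : ∀ i, ∀ x ∈ V i, fi i (f i x) = x)
    (hcomp : ∀ i j, ContDiffOn ℝ ∞ (f j ∘ fi i) (f i '' (V i ∩ V j))) :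
    ∃ (_ : ChartedSpace (EuclideanSpace ℝ (Fin 2)) X) (_ : IsManifold (𝓡 2) ∞ X),
      (∀ i, ContMDiffOn (𝓡 2) 𝓘(ℝ, EuclideanSpace ℝ (Fin 2)) ∞ (f i) (V i)) ∧
      (∀ i, ContMDiffOn 𝓘(ℝ, EuclideanSpace ℝ (Fin 2)) (𝓡 2) ∞ (fi i) (f i '' V i)) := by
  choose chart hsrc htgt hcoe hsymm using fun i =>
    exists_openPartialHomeomorph_of_isOpen_image (hV i) (hf i) (hopen i) (hleft i)
  letI cs : ChartedSpace (EuclideanSpace ℝ (Fin 2)) X :=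
    { atlas := range chart
      chartAt := fun x => chart (Classical.choose (hcover x))
      mem_chart_source := fun x => by
        rw [hsrc]
        exact Classical.choose_spec (hcover x)
      chart_mem_atlas := fun x => mem_range_self _ }
  haveI hM : IsManifold (𝓡 2) ∞ X := by
    refine isManifold_of_contDiffOn (𝓡 2) ∞ X ?_
    rintro _ _ ⟨i, rfl⟩ ⟨j, rfl⟩
    simp only [modelWithCornersSelf_coe, modelWithCornersSelf_coe_symm, range_id, inter_univ,
      preimage_id, Function.id_comp, Function.comp_id, OpenPartialHomeomorph.coe_trans,
      OpenPartialHomeomorph.trans_source, OpenPartialHomeomorph.symm_source, hcoe, hsymm, htgt,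
      hsrc]
    refine (hcomp i j).mono ?_
    rintro _ ⟨⟨x, hx, rfl⟩, hxj⟩
    rw [mem_preimage, hleft i x hx] at hxj
    exact ⟨x, ⟨hx, hxj⟩, rfl⟩
  refine ⟨cs, hM, fun i => ?_, fun i => ?_⟩
  · have h := contMDiffOn_of_mem_maximalAtlas (IsManifold.subset_maximalAtlas (mem_range_self i) :
      chart i ∈ IsManifold.maximalAtlas (𝓡 2) ∞ X)
    rwa [hcoe, hsrc] at h
  · have h := contMDiffOn_symm_of_mem_maximalAtlas
      (IsManifold.subset_maximalAtlas (mem_range_self i) :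
        chart i ∈ IsManifold.maximalAtlas (𝓡 2) ∞ X)
    rwa [hsymm, htgt] at h

/-! ### The registered stub -/

/-- **SEC-4 (generic topology; worker).**  (i) Invariance of domain on a space homeomorphic to `S²`:
continuous injections from its open subsets to `ℝ²` are open (tree `Brouwer.isOpen_image_of_injOn`
through the stereographic charts of Mathlib's sphere, `isOpen_image_of_injOn_of_sphereLike`);
(ii) a finite family of open topological embeddings `V_i → ℝ²` covering a Hausdorff space, with
`C^∞` transition maps, is an atlas of a `C^∞` manifold structure in which they are smooth with
smooth inverses (`isManifold_of_contDiffOn`, `exists_isManifold_of_finite_charts`; the Hausdorff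
hypothesis is not needed). -/
theorem stub_sec_atlas : (∀ (C : Type) [TopologicalSpace C], Nonempty (C ≃ₜ Metric.sphere (0 : E3) 1) → ∀ (V : Set C) (f : C → EuclideanSpace ℝ (Fin 2)), IsOpen V → ContinuousOn f V → InjOn f V → ∀ V' ⊆ V, IsOpen V' → IsOpen (f '' V')) ∧
    (∀ (X : Type) [TopologicalSpace X] [T2Space X] (N : ℕ) (V : Fin N → Set X) (f : Fin N → X → EuclideanSpace ℝ (Fin 2)) (fi : Fin N → EuclideanSpace ℝ (Fin 2) → X), (∀ i, IsOpen (V i)) → (∀ x, ∃ i, x ∈ V i) → (∀ i, ContinuousOn (f i) (V i)) → (∀ i, ∀ V' ⊆ V i, IsOpen V' → IsOpen (f i '' V')) → (∀ i, ∀ x ∈ V i, fi i (f i x) = x) → (∀ i j, ContDiffOn ℝ ∞ (f j ∘ fi i) (f i '' (V i ∩ V j))) → ∃ (_ : ChartedSpace (EuclideanSpace ℝ (Fin 2)) X) (_ : IsManifold (𝓡 2) ∞ X), (∀ i, ContMDiffOn (𝓡 2) 𝓘(ℝ, EuclideanSpace ℝ (Fin 2)) ∞ (f i) (V i)) ∧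 (∀ i, ContMDiffOn 𝓘(ℝ, EuclideanSpace ℝ (Fin 2)) (𝓡 2) ∞ (fi i) (f i '' V i))) := by
  refine ⟨?_, ?_⟩
  · intro C _ he V f _hV hf hinj V' hV'V hV'
    obtain ⟨e⟩ := he
    exact isOpen_image_of_injOn_of_sphereLike e hV' (hf.mono hV'V) (hinj.mono hV'V)
  · intro X _ _ N V f fi hV hcover hf hopen hleft hcomp
    exact exists_isManifold_of_finite_charts hV hcover hf hopen hleft hcomp

end Summit.FinalStateConjecture.FinalStateConjecture.Theorems.HawkingExtensionIsKerr.SketchIdeator2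

end
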